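import Summits.QuantumFields.YangMills.Theorems.BalabanUVNodesN15KingModelLandauFibre
import Summits.QuantumFields.YangMills.Theorems.BalabanUVNodesN15KingModelTorusPlaneWaves
import Literature.Analysis.Fourier.DiscreteCantorFUPProofs
import HarnessLib

/-!
# BalabanUVNodes ∕ N15 — THE KING-MODEL RUNG (PART Ϡ-b): THE LATTICE LANDAU LEVEL ON KING's TORUS — the constant-flux covariant Dirichlet form in the Landau gauge,
# `Σ_x(|w(x) − w(x+e_{ν₀})|² + |w(x) − χ_p(x)w(x+e_{ν₁})|²) ≥ Λ(p′_{ν₀})·Σ_x|w(x)|²`, `Λ(θ) = |sin θ|∕2 − (1−cos θ)²∕4`, by a partial Plancherel along `ν₁` and the Harper-fibre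
# bound of PART Ϡ-a along `ν₀` — uniformly in the period vector `K`
# (Track A, DAG node N15 = NE2; FAN-OUT v1.1 §N15 s3 «KING-MODEL RUNG … + what the curved case adds»; count-neutral)

HONEST FRAMING.  Count-neutral (cell `pub-ymgap`, seat `pub-ymgap-dag-n15-e` g47; `--supports stmt-QuantumFields-27247 --as helper` = K3ᴬ, KEY MAP v3).  Finite Fourier analysis on
King's torus `Tor K = Π_μ ℤ∕K_μ` ([King1986] (4.4) p.670; momenta and characters as in [Balaban1984PropagatorsI] (1.29) p.23, the tree's `B5Prop11Plancherel.chi`); the scalar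
(`U(1)`, one-component) Dirichlet form of the constant-flux field of PART Ͻ-q in the Landau gauge (`U(x,ν₁) = χ_p(x)`, `p_{ν₁} = 0`, all other links `1`).  Its reading for King's
covariant operator `−cΔ_U + m²` ([Balaban1985BackgroundPropagators] (3.23) p.394, PART Ͱ-a) is PART Ϡ-c.  NOT Bałaban's `G_k(U)`; NOT [Balaban1985BackgroundPropagators] (3.42);
NOT a node discharge (N15 of record untouched); nothing continuum ∕ ℝ⁴ ∕ OS ∕ Clay.

THE ARGUMENT.  (1) LINE AVERAGING (`sum_sum_add_single`): `Σ_xΣ_{s∈ℤ∕K_ν}F(x + s·e_ν) = K_ν·Σ_xF(x)`.  (2) Along `ν₁` the flux link is constant (`chi_add_single_of_apply_eq_zero`,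
`p_{ν₁} = 0`), so on each `ν₁`-line `s ↦ w(x + s e_{ν₁})` the two bond terms are `|u(s) − v(s)|²` and `|u(s) − χ_p(x)u(s+1)|²`; PLANCHEREL on `ℤ∕K_{ν₁}` (the tree's
`Literature.Analysis.Fourier.sum_norm_sq_dft`) and the SHIFT THEOREM (`dft_comp_add_right`) turn them into `K_{ν₁}⁻¹Σ_k|û(k) − v̂(k)|²` and `K_{ν₁}⁻¹Σ_k|1 − χ_p(x)χ(k)|²|û(k)|²`
(§2).  (3) Along `ν₀` the phase `ζ_j = χ_p(x + je_{ν₀})χ(k)` advances by `ω = χ_p(e_{ν₀}) = e^{ip′_{ν₀}}` (`King1986.Torus.chi_unitVec_eq_exp`), so PART Ϡ-a's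
`landau_fibre_bound_gap` applies line by line (§3 `landau_line_bound`).  (4) Undo the averaging (§4).
MAIN THEOREM ★★★ **`landau_torus_bound`**: for directions `ν₀, ν₁`, `p ∈ Tor K` with `p_{ν₁} = 0` and every `w : Tor K → ℂ`,
  `landauGap(p′_{ν₀})·Σ_x|w(x)|² ≤ Σ_x(|w(x) − w(x+e_{ν₀})|² + |w(x) − χ_p(x)·w(x+e_{ν₁})|²)`,  `p′ = sOf K p` (`∈ (−π,π]`),
with `landauGap θ = |sin θ|∕2 − (1−cos θ)²∕4 ≥ |θ|∕4` for `|θ| ≤ 1` (Ϡ-a) — THE LATTICE LANDAU LEVEL: a uniform flux `θ` per plaquette lifts the bottom of the two-dimensional covariant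
Dirichlet form by an amount LINEAR in `θ`, uniformly in the volume (PART Ϳ-c's plaquette road: `2(2−2cos(θ∕4)) ≈ θ²∕8`).
PRIOR TREE ART (by name): Ϡ-a (`landauGap`, `landau_fibre_bound_gap`), `TorusSpectral.norm_chi_eq_one`, `B5Prop11Plancherel` (`Tor`, `unitVec`, `chi`, `chi_add_right`, `chi_unitVec`, `sOf`),
`King1986.Torus.chi_unitVec_eq_exp`, `Literature.Analysis.Fourier` (`sum_norm_sq_dft`, `dft_comp_add_right`), Mathlib (`ZMod.dft`, `ZMod.card`, `Pi.single_add`, `Equiv.addRight`).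
Dedup (rg at filing): basename 0 files; needles `sum_sum_add_single|chi_add_single_of_apply_eq_zero|sum_norm_sq_sub_eq_dft|sum_norm_sq_sub_mul_succ_eq_dft|landau_line_bound|landau_torus_bound` 0 tree files
(dry-run v1 `dedup.landed`: a local `norm_stdAddChar` ≡ `Literature.NumberTheory.LFunctions.norm_stdAddChar` — dropped, the one-line fact is inlined).
Locators: [King1986] (4.4) p.670 (the operator), (2.12) p.653 (plaquette variables); [Balaban1984PropagatorsI] (1.29)–(1.31) p.23 (momenta `p′`); [Balaban1985BackgroundPropagators] (3.3) p.391,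
(3.23) p.394; the Landau-level ∕ Harper reading as in PART Ϡ-a's header (notion only).  0 `sorry`, 0 `def`.
-/

noncomputable section
open scoped BigOperators ComplexConjugate ZMod
open Finset

namespace Summit.QuantumFields.YangMills.BalabanUVNodes.N15KingModelRung.Landau

open Literature.MathematicalPhysics.QuantumFieldTheory.Balaban1983to89.B5Prop11Plancherel (Tor unitVec chi chi_add_right chi_unitVec sOf)
open Literature.MathematicalPhysics.QuantumFieldTheory.King1986.Torus (chi_unitVec_eq_exp)
open Summit.QuantumFields.YangMills.BalabanUVNodes.N15KingModelRung.TorusSpectral (norm_chi_eq_one)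
open Literature.Analysis.Fourier (sum_norm_sq_dft dft_comp_add_right)

variable {d : ℕ} (K : Fin (d + 1) → ℕ) [hK : ∀ μ, NeZero (K μ)]

/-! ## §1 Line averaging and the Landau-gauge bookkeeping on `Tor K` -/

section Lines

/-- ★ **LINE AVERAGING**: `Σ_x Σ_{s ∈ ℤ∕K_ν} F(x + s·e_ν) = K_ν • Σ_x F(x)` — every translate of the full sum is the full sum. [folklore] -/
theorem sum_sum_add_single {M : Type*} [AddCommMonoid M] (ν : Fin (d + 1)) (F : Tor K → M) :
    ∑ x : Tor K, ∑ s : ZMod (K ν), F (x + Pi.single ν s) = (K ν) • ∑ x : Tor K, F x := by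
  rw [Finset.sum_comm]
  have h : ∀ s : ZMod (K ν), ∑ x : Tor K, F (x + Pi.single ν s) = ∑ x : Tor K, F x := fun s =>
    Fintype.sum_equiv (Equiv.addRight (Pi.single ν s)) _ _ fun x => rfl
  simp_rw [h]
  rw [Finset.sum_const, Finset.card_univ, ZMod.card]

omit hK in
/-- One more unit step along `ν`: `x + s·e_ν + e_ν = x + (s+1)·e_ν`. [folklore] -/
theorem add_single_add_unitVec (x : Tor K) (ν : Fin (d + 1)) (s : ZMod (K ν)) : x + Pi.single ν s + unitVec K ν = x + Pi.single ν (s + 1) := by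
  rw [unitVec, add_assoc, ← Pi.single_add]

omit hK in
/-- Steps in different slots commute: `x + s·e_ν + e_μ = x + e_μ + s·e_ν`. [folklore] -/
theorem add_single_add_unitVec_comm (x : Tor K) (ν μ : Fin (d + 1)) (s : ZMod (K ν)) : x + Pi.single ν s + unitVec K μ = x + unitVec K μ + Pi.single ν s :=
  add_right_comm _ _ _

/-- `χ_p(s·e_ν) = χ(p_ν s)`. [cite: Balaban1984PropagatorsI, (1.29) p.23] -/
theorem chi_single (p : Tor K) (ν : Fin (d + 1)) (s : ZMod (K ν)) : chi K p (Pi.single ν s) = (ZMod.stdAddChar (N := K ν)) (p ν * s) := by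
  unfold chi
  rw [Finset.prod_eq_single ν (fun μ _ hμ => by rw [Pi.single_eq_of_ne hμ, mul_zero, AddChar.map_zero_eq_one]) (fun h => absurd (Finset.mem_univ ν) h), Pi.single_eq_same]

/-- ★ **THE LANDAU GAUGE IS CONSTANT ALONG `ν₁`**: `p_{ν₁} = 0 ⟹ χ_p(x + s·e_{ν₁}) = χ_p(x)`. [cite: Balaban1984PropagatorsI, (1.29) p.23] -/
theorem chi_add_single_of_apply_eq_zero {p : Tor K} {ν : Fin (d + 1)} (hp : p ν = 0) (x : Tor K) (s : ZMod (K ν)) : chi K p (x + Pi.single ν s) = chi K p x := by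
  rw [chi_add_right, chi_single, hp, zero_mul, AddChar.map_zero_eq_one, mul_one]

/-- Along `ν₀` the Landau phase advances by the plaquette: `χ_p(x + (j+1)·e_{ν₀}) = χ_p(e_{ν₀})·χ_p(x + j·e_{ν₀})`. [cite: King1986, (2.12) p.653] -/
theorem chi_add_single_succ (p x : Tor K) (ν : Fin (d + 1)) (j : ZMod (K ν)) :
    chi K p (x + Pi.single ν (j + 1)) = chi K p (unitVec K ν) * chi K p (x + Pi.single ν j) := by
  rw [← add_single_add_unitVec, chi_add_right, mul_comm]

end Lines

/-! ## §2 Partial Plancherel along one line -/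

section Plancherel

variable {N : ℕ} [NeZero N]

/-- PLANCHEREL FOR A DIFFERENCE: `N·Σ_s|u(s) − v(s)|² = Σ_k|û(k) − v̂(k)|²`. [folklore] -/
theorem sum_norm_sq_sub_eq_dft (u v : ZMod N → ℂ) : (N : ℝ) * ∑ s, ‖u s - v s‖ ^ 2 = ∑ k, ‖𝓕 u k - 𝓕 v k‖ ^ 2 := by
  have h := sum_norm_sq_dft (u - v)
  simp only [map_sub, Pi.sub_apply] at h
  exact h.symm

/-- PLANCHEREL FOR A TWISTED DIFFERENCE: `N·Σ_s|u(s) − c·u(s+1)|² = Σ_k|1 − c·χ(k)|²·|û(k)|²` (shift theorem: the translate by one has transform `χ(k)û(k)`). [folklore] -/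
theorem sum_norm_sq_sub_mul_succ_eq_dft (u : ZMod N → ℂ) (c : ℂ) :
    (N : ℝ) * ∑ s, ‖u s - c * u (s + 1)‖ ^ 2 = ∑ k, ‖1 - c * ZMod.stdAddChar k‖ ^ 2 * ‖𝓕 u k‖ ^ 2 := by
  have h := sum_norm_sq_dft (u - c • fun s => u (s + 1))
  simp only [map_sub, map_smul, Pi.sub_apply, Pi.smul_apply, smul_eq_mul] at h
  rw [h.symm]
  refine Finset.sum_congr rfl fun k _ => ?_
  rw [dft_comp_add_right u 1 k, one_mul, ← mul_pow, ← norm_mul]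
  congr 2; ring

end Plancherel

/-! ## §3 The fibre bound along one `ν₀`-line -/

section Line

/-- ★★ **THE LANDAU BOUND ALONG ONE `ν₀`-LINE**: for `H : Tor K → ℂ`, a base point `x`, a unit phase `c` and the Landau-gauge phases `ζ_j = χ_p(x + j·e_{ν₀})·c` (advancing by
`χ_p(e_{ν₀}) = e^{ip′_{ν₀}}`): `Λ(p′_{ν₀})·Σ_j|H(x+je_{ν₀})|² ≤ Σ_j(|H(x+je_{ν₀}) − H(x+je_{ν₀}+e_{ν₀})|² + |1 − ζ_j|²|H(x+je_{ν₀})|²)` — PART Ϡ-a's `landau_fibre_bound_gap` read on the line.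
[cite: King1986, (4.4) p.670, (2.12) p.653] -/
theorem landau_line_bound (p x : Tor K) (ν₀ : Fin (d + 1)) {c : ℂ} (hc : ‖c‖ = 1) (H : Tor K → ℂ) :
    landauGap (sOf K p ν₀) * ∑ j : ZMod (K ν₀), ‖H (x + Pi.single ν₀ j)‖ ^ 2
      ≤ ∑ j : ZMod (K ν₀), (‖H (x + Pi.single ν₀ j) - H (x + Pi.single ν₀ j + unitVec K ν₀)‖ ^ 2
          + ‖1 - chi K p (x + Pi.single ν₀ j) * c‖ ^ 2 * ‖H (x + Pi.single ν₀ j)‖ ^ 2) := by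
  set f : ZMod (K ν₀) → ℂ := fun j => H (x + Pi.single ν₀ j) with hf
  set ζ : ZMod (K ν₀) → ℂ := fun j => chi K p (x + Pi.single ν₀ j) * c with hζdef
  have hζ1 : ∀ j, ‖ζ j‖ = 1 := fun j => by simp only [hζdef]; rw [norm_mul, norm_chi_eq_one, hc, one_mul]
  have hζ : ∀ j, ζ (j + 1) = Complex.exp ((sOf K p ν₀ : ℝ) * Complex.I) * ζ j := fun j => by
    simp only [hζdef]; rw [chi_add_single_succ, chi_unitVec_eq_exp, mul_assoc]
  have h := landau_fibre_bound_gap f hζ1 hζ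
  have hsucc : ∀ j, f (j + 1) = H (x + Pi.single ν₀ j + unitVec K ν₀) := fun j => by simp only [hf]; rw [add_single_add_unitVec]
  rw [Finset.sum_add_distrib]
  refine h.trans (le_of_eq ?_)
  congr 1
  refine Finset.sum_congr rfl fun j _ => ?_
  rw [hsucc, norm_sub_rev]

end Line

/-! ## §4 The torus bound -/

section Torus

/-- ★★★ **THE LATTICE LANDAU LEVEL ON KING's TORUS**: for directions `ν₀, ν₁` (the case `ν₀ = ν₁` is trivial: then `p′_{ν₀} = 0` and `Λ = 0`), a momentum `p` with `p_{ν₁} = 0`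
(Landau gauge) and every `w : Tor K → ℂ`,
`Λ(p′_{ν₀})·Σ_x|w(x)|² ≤ Σ_x(|w(x) − w(x+e_{ν₀})|² + |w(x) − χ_p(x)·w(x+e_{ν₁})|²)`, `Λ(θ) = |sin θ|∕2 − (1−cos θ)²∕4` — the covariant two-dimensional Dirichlet form of the
constant-flux field (flux `χ_p(e_{ν₀}) = e^{ip′_{ν₀}}` through every `(ν₀,ν₁)`-plaquette) is bounded below LINEARLY in the flux angle, uniformly in the volume.
[cite: King1986, (4.4) p.670, (2.12) p.653; Balaban1985BackgroundPropagators, (3.3) p.391, (3.23) p.394; Balaban1984PropagatorsI, (1.29) p.23] -/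
theorem landau_torus_bound (ν₀ : Fin (d + 1)) {ν₁ : Fin (d + 1)} {p : Tor K} (hp : p ν₁ = 0) (w : Tor K → ℂ) :
    landauGap (sOf K p ν₀) * ∑ x, ‖w x‖ ^ 2 ≤ ∑ x, (‖w x - w (x + unitVec K ν₀)‖ ^ 2 + ‖w x - chi K p x * w (x + unitVec K ν₁)‖ ^ 2) := by
  -- notation
  set N₀ : ℕ := K ν₀ with hN₀
  set N₁ : ℕ := K ν₁ with hN₁
  have hN₁pos : (0 : ℝ) < N₁ := by exact_mod_cast Nat.pos_of_ne_zero (NeZero.ne (K ν₁))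
  have hN₀pos : (0 : ℝ) < N₀ := by exact_mod_cast Nat.pos_of_ne_zero (NeZero.ne (K ν₀))
  -- the `ν₁`-lines and their Fourier transforms
  set ℓ : Tor K → ZMod N₁ → ℂ := fun x s => w (x + Pi.single ν₁ s) with hℓ
  set F : Tor K → ZMod N₁ → ℂ := fun x => 𝓕 (ℓ x) with hF
  set A : Tor K → ZMod N₁ → ℝ := fun x k => ‖F x k - F (x + unitVec K ν₀) k‖ ^ 2 + ‖1 - chi K p x * ZMod.stdAddChar k‖ ^ 2 * ‖F x k‖ ^ 2 with hA
  set G : Tor K → ℝ := fun x => ‖w x - w (x + unitVec K ν₀)‖ ^ 2 + ‖w x - chi K p x * w (x + unitVec K ν₁)‖ ^ 2 with hG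
  -- Step 1+2: `N₁²·Σ_x G x = Σ_x Σ_k A x k`
  have hline : ∀ x, (N₁ : ℝ) * ∑ s : ZMod N₁, G (x + Pi.single ν₁ s) = ∑ k, A x k := by
    intro x
    have h1 : ∀ s : ZMod N₁, G (x + Pi.single ν₁ s) = ‖ℓ x s - ℓ (x + unitVec K ν₀) s‖ ^ 2 + ‖ℓ x s - chi K p x * ℓ x (s + 1)‖ ^ 2 := by
      intro s
      simp only [hG, hℓ]
      rw [add_single_add_unitVec_comm, chi_add_single_of_apply_eq_zero K hp, add_single_add_unitVec]
    simp_rw [h1]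
    rw [Finset.sum_add_distrib, mul_add, sum_norm_sq_sub_eq_dft, sum_norm_sq_sub_mul_succ_eq_dft, ← Finset.sum_add_distrib]
  have hstep12 : (N₁ : ℝ) * ((N₁ : ℝ) * ∑ x, G x) = ∑ x, ∑ k, A x k := by
    have h := sum_sum_add_single K ν₁ G
    rw [nsmul_eq_mul] at h
    rw [← h, Finset.mul_sum]
    exact Finset.sum_congr rfl fun x _ => hline x
  -- Step 3: `N₀·Σ_x Σ_k A x k ≥ Λ·N₀·Σ_x Σ_k |F x k|²`
  have hstep3 : landauGap (sOf K p ν₀) * ((N₀ : ℝ) * ∑ x, ∑ k, ‖F x k‖ ^ 2) ≤ (N₀ : ℝ) * ∑ x, ∑ k, A x k := by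
    have hA' := sum_sum_add_single K ν₀ (fun x => ∑ k, A x k)
    have hF' := sum_sum_add_single K ν₀ (fun x => ∑ k, ‖F x k‖ ^ 2)
    rw [nsmul_eq_mul] at hA' hF'
    rw [← hA', ← hF', Finset.mul_sum]
    refine Finset.sum_le_sum fun x _ => ?_
    conv_lhs => rw [Finset.sum_comm]
    conv_rhs => rw [Finset.sum_comm]
    rw [Finset.mul_sum]
    refine Finset.sum_le_sum fun k _ => ?_
    -- the line bound for `H = F · k`, `c = χ(k)`
    have hck : ‖(ZMod.stdAddChar k : ℂ)‖ = 1 := by rw [ZMod.stdAddChar_apply]; exact Circle.norm_coe _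
    have h := landau_line_bound K p x ν₀ hck (fun y => F y k)
    simpa only [hA] using h
  -- Step 4: `Σ_x Σ_k |F x k|² = N₁²·Σ_x |w x|²`
  have hstep4 : ∑ x, ∑ k, ‖F x k‖ ^ 2 = (N₁ : ℝ) * ((N₁ : ℝ) * ∑ x, ‖w x‖ ^ 2) := by
    have h := sum_sum_add_single K ν₁ (fun x => ‖w x‖ ^ 2)
    rw [nsmul_eq_mul] at h
    rw [← h, Finset.mul_sum]
    refine Finset.sum_congr rfl fun x _ => ?_
    simp only [hF]
    exact sum_norm_sq_dft (ℓ x)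
  -- assemble
  have h3' : landauGap (sOf K p ν₀) * ∑ x, ∑ k, ‖F x k‖ ^ 2 ≤ ∑ x, ∑ k, A x k := by
    have := hstep3
    rw [mul_left_comm] at this
    exact le_of_mul_le_mul_left this hN₀pos
  rw [hstep4, ← hstep12] at h3'
  have h5 : (N₁ : ℝ) * ((N₁ : ℝ) * (landauGap (sOf K p ν₀) * ∑ x, ‖w x‖ ^ 2)) ≤ (N₁ : ℝ) * ((N₁ : ℝ) * ∑ x, G x) := by
    calc (N₁ : ℝ) * ((N₁ : ℝ) * (landauGap (sOf K p ν₀) * ∑ x, ‖w x‖ ^ 2)) = landauGap (sOf K p ν₀) * ((N₁ : ℝ) * ((N₁ : ℝ) * ∑ x, ‖w x‖ ^ 2)) := by ring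
      _ ≤ _ := h3'
  exact le_of_mul_le_mul_left (le_of_mul_le_mul_left h5 hN₁pos) hN₁pos

/-- ★★ THE SMALL-FLUX FORM: for `|p′_{ν₀}| ≤ 1` the bound reads `(|p′_{ν₀}|∕4)·Σ_x|w(x)|² ≤ Σ_x(…)` (Ϡ-a `landauGap_ge_quarter`). [cite: King1986, (4.4) p.670] -/
theorem landau_torus_bound_quarter (ν₀ : Fin (d + 1)) {ν₁ : Fin (d + 1)} {p : Tor K} (hp : p ν₁ = 0) (hsmall : |sOf K p ν₀| ≤ 1) (w : Tor K → ℂ) :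
    |sOf K p ν₀| / 4 * ∑ x, ‖w x‖ ^ 2 ≤ ∑ x, (‖w x - w (x + unitVec K ν₀)‖ ^ 2 + ‖w x - chi K p x * w (x + unitVec K ν₁)‖ ^ 2) :=
  le_trans (mul_le_mul_of_nonneg_right (landauGap_ge_quarter hsmall) (Finset.sum_nonneg fun _ _ => sq_nonneg _)) (landau_torus_bound K ν₀ hp w)

end Torus

end Summit.QuantumFields.YangMills.BalabanUVNodes.N15KingModelRung.Landau

end
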